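import Literature.NumberTheory.EllipticCurves.SelmerPInftyIsogeny
import Literature.NumberTheory.EllipticCurves.ZpCorankQuasiIso
import Literature.NumberTheory.EllipticCurves.SelmerCorankAssembly
import Literature.NumberTheory.EllipticCurves.IsogenyDualProofs
import Literature.Algebra.Module.AlternatingPairingParity
import HarnessLib

/-!
# The divisible part of `Sel_{p^∞}` under an isogeny: Smith's Prop. 1.18

Topic `NumberTheory/EllipticCurves`. Companion `…Proofs` file (theorems only) of
`SelmerPInftyIsogeny` (`galH1PrimaryMap` = `φ_*`, `selmerDivisiblePart` = `Sel_div`,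
`selmerDivRank` = `r_{φ,div}`). For a Weierstrass curve `E = W` over a number field `K` and a
prime `p` such that `Sel_{p^∞}(E/K)[p]` is finite (always, for an elliptic curve:
`WeierstrassCurve.finite_torsionBy_selmerGroupPInfty`; kept as an instance hypothesis
`[Finite (Sel_{p^∞})[p]]` to keep this file's imports light):

* §1 `Sel_div`: it is `p^k · Sel_{p^∞}` for every large `k`, it is divisible, it contains every
  `p`-divisible subgroup of `Sel_{p^∞}` (so it is exactly the subgroup of divisible elements,
  `mem_selmerDivisiblePart_iff_forall_exists_nsmul_eq`), `Sel_{p^∞} / Sel_div` is finite and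
  **`#Sel_div[p] = p ^ corank_{ℤ_p} Sel_{p^∞}`** (`natCard_torsionBy_selmerDivisiblePart`) — the
  content of "`r_{2^∞}(E^d)` equals the corank of `Sel^{2^∞} E^d`", i.e. of Smith's Notation 1.8
  (`r_{2^∞} = lim_k r_{2^k}`), for the tree's corank `zpCorank`.
* §2 Exactness at `H¹(K, E[p^∞])` of the cohomology of `0 → E[φ] ∩ E[p^∞] → E[p^∞] →(φ) E'[p^∞] → 0`
  (`mem_ker_galH1PrimaryMap_iff`): a class dies under `φ_*` iff it is represented by a
  continuous cocycle killed by `φ`, i.e. with values in `E[φ]` — "from the exact sequence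
  `H¹(G_ℚ, E^d[φ]) → H¹(G_ℚ, E^d[2^∞]) → H¹(G_ℚ, E^d_0[2^∞])`" (Smith, proof of Prop. 1.18); the
  needed surjectivity of an isogeny on `p^∞`-torsion is `Isogeny.primaryTorsionMap_surjective`.
* §3 Functoriality: `φ_* (Sel_div E) ⊆ Sel_div E'`, with equality when `φ` has a "dual" `ψ`
  with `φ ∘ ψ = [n]`, `n ≠ 0` (`map_galH1PrimaryMap_selmerDivisiblePart_eq`), and the kernel
  count along `Sel_div E →(φ_*) Sel_div E' →(ψ_*) Sel_div E`, `ψ_* φ_* = n`: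
  `#Sel_div(E)[n] = #(Sel_div E ∩ ker φ_*) · #(Sel_div E' ∩ ker ψ_*)`.
* §4 **Smith's Prop. 1.18** (arXiv:2503.17619, second equality), for an isogeny `φ : E → E'` of
  elliptic curves over a number field with `ψ ∘ φ = [p]` (Smith: `p = 2`, `deg φ = 2`, `ψ = φ'`
  the dual isogeny): `corank_{ℤ_p} Sel_{p^∞}(E/K) = r_{φ,div}(E) + r_{ψ,div}(E')`
  (`Isogeny.selmerCorank_eq_divRank_add_divRank`), together with `ker φ_* ∩ Sel_div` being
  `p`-torsion of dimension `r_{φ,div}` (`natCard_selmerDivisiblePart_inf_ker`). The first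
  equality of Prop. 1.18, `r_{p^∞}(E) = r_{p^∞}(E')`, is `Isogeny.selmerCorank_eq`
  (`SelmerCorankIsogenyProofs`).

No definitions, no named facts.

## References

* A. Smith, *The Birch and Swinnerton-Dyer conjecture implies Goldfeld's conjecture*,
  arXiv:2503.17619 (2025), §1.2: Def. 1.16, Prop. 1.18 and its proof. [arXiv250317619]
* R. Greenberg, *Iwasawa theory for elliptic curves*, LNM 1716 (1999), §1 (coranks; cofinitely
  generated `p`-primary groups). [Greenberg1999LNM]
* L. Fuchs, *Infinite Abelian Groups* I (1970), §20–§23 (divisible subgroups). [folklore]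
-/

noncomputable section

open scoped Classical
open scoped AddSubgroup

universe u

namespace Literature.NumberTheory.EllipticCurves

open WeierstrassCurve Literature.NumberTheory.GaloisRepresentations

/-! ## §0 Two lemmas on subgroups `n • H` -/

section NSMul

variable {A : Type*} [AddCommGroup A]

/-- `H.map (n • ·)`, computed inside `H`: it is the image under `H ↪ A` of `n • ⊤ ≤ H`. [folklore] -/
theorem map_nsmulAddMonoidHom_eq_map_subtype (H : AddSubgroup A) (n : ℕ) :
    H.map (nsmulAddMonoidHom n) =
      ((⊤ : AddSubgroup H).map (nsmulAddMonoidHom n)).map H.subtype := by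
  ext x
  simp only [AddSubgroup.mem_map, nsmulAddMonoidHom_apply, AddSubgroup.mem_top, true_and,
    AddSubgroup.coe_subtype, exists_exists_eq_and, AddSubgroupClass.coe_nsmul]
  constructor
  · rintro ⟨h, hh, rfl⟩
    exact ⟨⟨h, hh⟩, rfl⟩
  · rintro ⟨h, rfl⟩
    exact ⟨h, h.2, rfl⟩

/-- The chain `p^k • H` is antitone in `k`. [folklore] -/
theorem map_nsmulAddMonoidHom_pow_anti (H : AddSubgroup A) (p : ℕ) {k j : ℕ} (hkj : k ≤ j) :
    H.map (nsmulAddMonoidHom (p ^ j)) ≤ H.map (nsmulAddMonoidHom (p ^ k)) := by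
  rintro _ ⟨h, hh, rfl⟩
  obtain ⟨i, rfl⟩ := Nat.exists_eq_add_of_le hkj
  refine ⟨p ^ i • h, H.nsmul_mem hh _, ?_⟩
  simp only [nsmulAddMonoidHom_apply, smul_smul, ← pow_add]

end NSMul

/-! ## §1 The divisible part of `Sel_{p^∞}` -/

section DivisiblePart

variable {K : Type u} [Field K]

/-- `H¹(K, E[p^∞])` is `p`-primary (a continuous cocycle on the compact `Γ_K` with values in the
discrete `p`-primary `E[p^∞]` is killed by one power of `p`): its `p`-primary component is
everything. Greenberg (1999), §2. [folklore] -/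
theorem primaryComponent_galH1Primary_eq_top [PerfectField K] (W : WeierstrassCurve K) (p : ℕ) :
    AddCommGroup.primaryComponent (galH1Primary W p) p = ⊤ := by
  haveI : CompactSpace (Field.absoluteGaloisGroup K) := compactSpace_absoluteGaloisGroup K
  refine eq_top_iff.mpr fun x _ ↦ ?_
  obtain ⟨f, rfl⟩ := oneCocycleClass_surjective _ x
  obtain ⟨k, hk⟩ := exists_pow_smul_apply_eq_zero f.1 fun g ↦ by
    obtain ⟨k, hk⟩ := AddCommGroup.mem_primaryComponent.mp (f.1 g).2
    exact ⟨k, Subtype.ext (by rw [AddSubmonoidClass.coe_nsmul, hk, ZeroMemClass.coe_zero])⟩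
  exact (AddCommGroup.mem_primaryComponent).mpr ⟨k, nsmul_oneCocycleClass_eq_zero f (p ^ k) hk⟩

variable [NumberField K] (W : WeierstrassCurve K) (p : ℕ)

/-- Every element of a subgroup of `H¹(K, E[p^∞])` — in particular of `Sel_{p^∞}(E/K)` — has
`p`-power order. [folklore] -/
theorem exists_pow_nsmul_eq_zero_of_mem (H : AddSubgroup (galH1Primary W p)) (x : H) :
    ∃ k : ℕ, p ^ k • x = 0 := by
  have hx : (x : galH1Primary W p) ∈ AddCommGroup.primaryComponent (galH1Primary W p) p := by
    rw [primaryComponent_galH1Primary_eq_top]; trivial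
  obtain ⟨k, hk⟩ := (AddCommGroup.mem_primaryComponent).mp hx
  exact ⟨k, Subtype.ext (by rw [AddSubgroupClass.coe_nsmul, hk, ZeroMemClass.coe_zero])⟩

/-- The `p`-primary component of `Sel_{p^∞}(E/K)` (as a group) is everything. [folklore] -/
theorem primaryComponent_selmerGroupPInfty_eq_top :
    AddCommGroup.primaryComponent (selmerGroupPInfty W p) p = ⊤ :=
  eq_top_iff.mpr fun x _ ↦ (AddCommGroup.mem_primaryComponent).mpr
    (exists_pow_nsmul_eq_zero_of_mem W p _ x)

/-- **Every `p`-divisible subgroup of `Sel_{p^∞}` lies in `Sel_div`**: if `H ≤ Sel_{p^∞}` and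
every `h ∈ H` is `p • h'` with `h' ∈ H`, then `H ≤ ⋂_k p^k Sel_{p^∞}`. [folklore] -/
theorem le_selmerDivisiblePart_of_pDivisible {H : AddSubgroup (galH1Primary W p)}
    (hHS : H ≤ selmerGroupPInfty W p) (hdiv : ∀ h ∈ H, ∃ h' ∈ H, p • h' = h) :
    H ≤ selmerDivisiblePart W p := by
  have hpow : ∀ k : ℕ, ∀ h ∈ H, ∃ h' ∈ H, p ^ k • h' = h := by
    intro k
    induction k with
    | zero => exact fun h hh ↦ ⟨h, hh, by rw [pow_zero, one_smul]⟩
    | succ k ih =>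
      intro h hh
      obtain ⟨h₁, hh₁, rfl⟩ := hdiv h hh
      obtain ⟨h₂, hh₂, rfl⟩ := ih h₁ hh₁
      exact ⟨h₂, hh₂, by rw [pow_succ', mul_smul]⟩
  intro h hh
  refine (mem_selmerDivisiblePart_iff W p h).mpr fun k ↦ ?_
  obtain ⟨h', hh', rfl⟩ := hpow k h hh
  exact ⟨h', hHS hh', rfl⟩

variable [Finite (selmerGroupPInfty W p)[(p : ℤ)]]

/-- **`Sel_div = p^K Sel_{p^∞}` is `p`-divisible, for some `K`.** From the stabilisation of the
chain `p^k Sel_{p^∞}` (`Literature.Algebra.Module.exists_pDivisible_nsmul_map`, applied inside the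
`p`-primary group `Sel_{p^∞}` with finite `p`-torsion): some `p^K Sel_{p^∞}` is `p`-divisible,
hence contained in `Sel_div` (`le_selmerDivisiblePart_of_pDivisible`), hence equal to it. The
elementary shadow of `Sel_{p^∞} ≅ (ℚ_p/ℤ_p)^r ⊕ (finite)` (Greenberg 1999, §1). [folklore] -/
theorem exists_selmerDivisiblePart_eq_map_and_pDivisible :
    ∃ K : ℕ, selmerDivisiblePart W p = (selmerGroupPInfty W p).map (nsmulAddMonoidHom (p ^ K)) ∧
      ∀ d ∈ selmerDivisiblePart W p, ∃ d' ∈ selmerDivisiblePart W p, p • d' = d := by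
  set S := selmerGroupPInfty W p with hS_def
  obtain ⟨K, -, hK⟩ := Literature.Algebra.Module.exists_pDivisible_nsmul_map (A := S) (p := p)
  rw [primaryComponent_selmerGroupPInfty_eq_top] at hK
  set DS : AddSubgroup S := (⊤ : AddSubgroup S).map (nsmulAddMonoidHom (p ^ K)) with hDS_def
  have hmap : S.map (nsmulAddMonoidHom (p ^ K)) = DS.map S.subtype :=
    map_nsmulAddMonoidHom_eq_map_subtype S (p ^ K)
  -- `p^K S` is `p`-divisible (inside `H¹`)
  have hdiv : ∀ d ∈ S.map (nsmulAddMonoidHom (p ^ K)), ∃ d' ∈ S.map (nsmulAddMonoidHom (p ^ K)),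
      p • d' = d := by
    intro d hd
    rw [hmap] at hd ⊢
    obtain ⟨x, hx, rfl⟩ := hd
    obtain ⟨x', hx', rfl⟩ := hK x hx
    exact ⟨(x' : galH1Primary W p), ⟨x', hx', rfl⟩, by rw [AddSubgroup.coe_subtype,
      AddSubgroupClass.coe_nsmul]⟩
  have hle : S.map (nsmulAddMonoidHom (p ^ K)) ≤ S := by
    rintro _ ⟨s, hs, rfl⟩
    exact S.nsmul_mem hs _
  have heq : selmerDivisiblePart W p = S.map (nsmulAddMonoidHom (p ^ K)) :=
    le_antisymm (selmerDivisiblePart_le_map W p K)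
      (le_selmerDivisiblePart_of_pDivisible W p hle hdiv)
  exact ⟨K, heq, by rw [heq]; exact hdiv⟩

/-- **`Sel_div = p^k Sel_{p^∞}` for every large `k`.** [folklore] -/
theorem exists_forall_selmerDivisiblePart_eq_map :
    ∃ K : ℕ, ∀ k, K ≤ k →
      selmerDivisiblePart W p = (selmerGroupPInfty W p).map (nsmulAddMonoidHom (p ^ k)) := by
  obtain ⟨K, hK, -⟩ := exists_selmerDivisiblePart_eq_map_and_pDivisible W p
  refine ⟨K, fun k hk ↦ le_antisymm (selmerDivisiblePart_le_map W p k) ?_⟩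
  rw [hK]
  exact map_nsmulAddMonoidHom_pow_anti _ p hk

/-- **`Sel_div` is `p`-divisible.** [folklore] -/
theorem selmerDivisiblePart_pDivisible {d : galH1Primary W p} (hd : d ∈ selmerDivisiblePart W p) :
    ∃ d' ∈ selmerDivisiblePart W p, p • d' = d := by
  obtain ⟨_, -, h⟩ := exists_selmerDivisiblePart_eq_map_and_pDivisible W p
  exact h d hd

/-- The `p`-torsion of `Sel_div` is finite (it embeds in `Sel_{p^∞}[p]`). [folklore] -/
theorem finite_torsionBy_selmerDivisiblePart : Finite (selmerDivisiblePart W p)[(p : ℤ)] := by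
  refine Finite.of_injective (fun x : (selmerDivisiblePart W p)[(p : ℤ)] ↦
    (⟨⟨((x : selmerDivisiblePart W p) : galH1Primary W p), selmerDivisiblePart_le W p x.1.2⟩,
      AddSubgroup.torsionBy.nsmul_iff.mpr (Subtype.ext ?_)⟩ : (selmerGroupPInfty W p)[(p : ℤ)])) ?_
  · have h := congrArg (fun z : selmerDivisiblePart W p ↦ (z : galH1Primary W p))
      (AddSubgroup.torsionBy.nsmul_iff.mp x.2)
    simpa only [AddSubgroupClass.coe_nsmul, ZeroMemClass.coe_zero] using h
  · intro x y hxy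
    exact Subtype.ext (Subtype.ext (congrArg
      (fun z : (selmerGroupPInfty W p)[(p : ℤ)] ↦ ((z : selmerGroupPInfty W p) : galH1Primary W p))
      hxy))

variable [hp : Fact p.Prime]

/-- **`Sel_div` is divisible**: every element is `n • d'` with `d' ∈ Sel_div`, for every `n ≥ 1`
(`p`-power part by `p`-divisibility, prime-to-`p` part invertibly on an element of `p`-power
order). [folklore] -/
theorem selmerDivisiblePart_divisible {d : galH1Primary W p} (hd : d ∈ selmerDivisiblePart W p)
    {n : ℕ} (hn : 0 < n) : ∃ d' ∈ selmerDivisiblePart W p, n • d' = d := by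
  have hpow : ∀ j : ℕ, ∀ d ∈ selmerDivisiblePart W p, ∃ d' ∈ selmerDivisiblePart W p,
      p ^ j • d' = d := by
    intro j
    induction j with
    | zero => exact fun d hd ↦ ⟨d, hd, by rw [pow_zero, one_smul]⟩
    | succ j ih =>
      intro d hd
      obtain ⟨d₁, hd₁, rfl⟩ := selmerDivisiblePart_pDivisible W p hd
      obtain ⟨d₂, hd₂, rfl⟩ := ih d₁ hd₁
      exact ⟨d₂, hd₂, by rw [pow_succ', mul_smul]⟩
  obtain ⟨j, m, hm, rfl⟩ := Nat.exists_eq_pow_mul_and_not_dvd hn.ne' p hp.out.ne_one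
  obtain ⟨d', hd', rfl⟩ := hpow j d hd
  -- `d'` has `p`-power order `p ^ a`; `m` is invertible modulo `p ^ a`
  obtain ⟨a, ha⟩ : ∃ a : ℕ, p ^ a • d' = 0 := by
    have h := exists_pow_nsmul_eq_zero_of_mem W p (selmerDivisiblePart W p) ⟨d', hd'⟩
    obtain ⟨a, ha⟩ := h
    exact ⟨a, by simpa using congrArg (fun z : selmerDivisiblePart W p ↦ (z : galH1Primary W p)) ha⟩
  rcases Nat.eq_zero_or_pos a with rfl | hapos
  · rw [pow_zero, one_smul] at ha
    exact ⟨0, zero_mem _, by rw [ha, smul_zero, smul_zero]⟩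
  have hcop : Nat.Coprime m (p ^ a) :=
    (((Nat.Prime.coprime_iff_not_dvd hp.out).mpr hm).symm).pow_right a
  obtain ⟨u, -, hu⟩ := Nat.exists_mul_mod_eq_one_of_coprime hcop
    (Nat.one_lt_pow hapos.ne' hp.out.one_lt)
  have hmu : (m * u) • d' = d' := by rw [nsmul_eq_mod_nsmul (m * u) ha, hu, one_smul]
  refine ⟨u • d', AddSubgroup.nsmul_mem _ hd' u, ?_⟩
  calc (p ^ j * m) • u • d' = p ^ j • ((m * u) • d') := by rw [mul_smul, mul_smul]
    _ = p ^ j • d' := by rw [hmu]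

/-- **`Sel_div` is the subgroup of divisible elements of `Sel_{p^∞}`** (Smith's wording,
arXiv:2503.17619, Def. 1.16): `c ∈ Sel_div` iff `c ∈ Sel_{p^∞}` and `c` is divisible inside
`Sel_{p^∞}` by every `n ≥ 1`. [cite: arXiv250317619, Def. 1.16] -/
theorem mem_selmerDivisiblePart_iff_forall_exists_nsmul_eq (c : galH1Primary W p) :
    c ∈ selmerDivisiblePart W p ↔
      c ∈ selmerGroupPInfty W p ∧ ∀ n : ℕ, 0 < n → ∃ s ∈ selmerGroupPInfty W p, n • s = c := by
  constructor
  · intro hc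
    refine ⟨selmerDivisiblePart_le W p hc, fun n hn ↦ ?_⟩
    obtain ⟨d', hd', rfl⟩ := selmerDivisiblePart_divisible W p hc hn
    exact ⟨d', selmerDivisiblePart_le W p hd', rfl⟩
  · rintro ⟨-, h⟩
    refine (mem_selmerDivisiblePart_iff W p c).mpr fun k ↦ ?_
    exact h (p ^ k) (pow_pos hp.out.pos k)

/-- **`Sel_{p^∞} / Sel_div` is finite** (killed by `p^K`, with finite `p`-torsion).
Greenberg (1999), §1 (`Sel_{p^∞} ≅ (ℚ_p/ℤ_p)^r ⊕` finite). [folklore] -/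
theorem finite_selmerGroupPInfty_quotient_selmerDivisiblePart :
    Finite (selmerGroupPInfty W p ⧸ (selmerDivisiblePart W p).addSubgroupOf (selmerGroupPInfty W p)) := by
  set S := selmerGroupPInfty W p with hS_def
  set DS := (selmerDivisiblePart W p).addSubgroupOf S with hDS_def
  obtain ⟨K, hK, -⟩ := exists_selmerDivisiblePart_eq_map_and_pDivisible W p
  have hSprim : ∀ s : S, ∃ n : ℕ, p ^ n • s = 0 := exists_pow_nsmul_eq_zero_of_mem W p S
  -- `0 → DS → S → S/DS → 0` : the quotient is `p`-primary with finite `p`-torsion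
  haveI : Finite (S ⧸ DS)[(p : ℤ)] :=
    finite_torsionBy_of_shortExact (i := DS.subtype) (f := QuotientAddGroup.mk' DS)
      Subtype.val_injective (QuotientAddGroup.mk'_surjective _)
      (fun s hs ↦ by
        rw [QuotientAddGroup.mk'_apply, QuotientAddGroup.eq_zero_iff] at hs
        exact ⟨⟨s, hs⟩, rfl⟩)
      (fun x ↦ by rw [QuotientAddGroup.mk'_apply, QuotientAddGroup.eq_zero_iff]; exact x.2) hSprim
  have hQ : ∀ q : S ⧸ DS, ∃ n : ℕ, p ^ n • q = 0 := fun q ↦ by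
    induction q using QuotientAddGroup.induction_on with
    | H s =>
      obtain ⟨n, hn⟩ := hSprim s
      exact ⟨n, by rw [← QuotientAddGroup.mk_nsmul, hn, QuotientAddGroup.mk_zero]⟩
  refine finite_of_primary_of_nsmul_eq_zero hp.out hQ (pow_ne_zero K hp.out.ne_zero) fun q ↦ ?_
  induction q using QuotientAddGroup.induction_on with
  | H s =>
    rw [← QuotientAddGroup.mk_nsmul, QuotientAddGroup.eq_zero_iff, hDS_def,
      AddSubgroup.mem_addSubgroupOf, AddSubgroupClass.coe_nsmul, hK]
    exact ⟨s, s.2, rfl⟩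

/-- **`corank_{ℤ_p} Sel_{p^∞} = corank_{ℤ_p} Sel_div`** (the quotient is finite; additivity of
the corank on `0 → Sel_div → Sel_{p^∞} → Sel_{p^∞}/Sel_div → 0`). Greenberg (1999), §1.
[folklore] -/
theorem selmerCorank_eq_zpCorank_selmerDivisiblePart :
    W.selmerCorank p = zpCorank (selmerDivisiblePart W p) p := by
  set S := selmerGroupPInfty W p with hS_def
  set DS := (selmerDivisiblePart W p).addSubgroupOf S with hDS_def
  haveI := finite_selmerGroupPInfty_quotient_selmerDivisiblePart W p
  have hSprim : ∀ s : S, ∃ n : ℕ, p ^ n • s = 0 := exists_pow_nsmul_eq_zero_of_mem W p S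
  have h := zpCorank_eq_of_shortExact_of_finite_right (p := p)
    (i := AddSubgroup.inclusion (selmerDivisiblePart_le W p)) (f := QuotientAddGroup.mk' DS)
    (AddSubgroup.inclusion_injective _) (QuotientAddGroup.mk'_surjective _)
    (fun s hs ↦ by
      rw [QuotientAddGroup.mk'_apply, QuotientAddGroup.eq_zero_iff, hDS_def,
        AddSubgroup.mem_addSubgroupOf] at hs
      exact ⟨⟨s, hs⟩, Subtype.ext rfl⟩)
    (fun x ↦ by
      rw [QuotientAddGroup.mk'_apply, QuotientAddGroup.eq_zero_iff, hDS_def,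
        AddSubgroup.mem_addSubgroupOf]
      exact x.2) hSprim
  exact h.symm

/-- **`#Sel_div[p] = p ^ corank_{ℤ_p} Sel_{p^∞}(E/K)`.** `Sel_div` is `p`-divisible, so
`Sel_div / p Sel_div = 0` and its corank formula is `dim_{𝔽_p} Sel_div[p]`; and
`corank Sel_{p^∞} = corank Sel_div`. This is "`r_{p^∞}` equals the corank of `Sel^{p^∞}`"
(Smith, arXiv:2503.17619, Notation 1.8 and proof of Prop. 1.18) for the tree's `zpCorank`.
[folklore] -/
theorem natCard_torsionBy_selmerDivisiblePart :
    Nat.card (selmerDivisiblePart W p)[(p : ℤ)] = p ^ W.selmerCorank p := by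
  set D := selmerDivisiblePart W p with hD_def
  haveI := finite_torsionBy_selmerDivisiblePart W p
  letI : Module (ZMod p) D[(p : ℤ)] := AddSubgroup.torsionBy.zmodModule
  -- `D / pD = 0`
  haveI : Subsingleton (ModN D p) := by
    have hzero : ∀ x : D, (Submodule.Quotient.mk x : ModN D p) = 0 := fun x ↦ by
      rw [Submodule.Quotient.mk_eq_zero, LinearMap.mem_range]
      obtain ⟨d', hd', hd'eq⟩ := selmerDivisiblePart_pDivisible W p x.2
      exact ⟨⟨d', hd'⟩, Subtype.ext (by
        rw [LinearMap.lsmul_apply, natCast_zsmul, AddSubgroupClass.coe_nsmul]; exact hd'eq)⟩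
    refine ⟨fun x y ↦ ?_⟩
    obtain ⟨x, rfl⟩ := Submodule.Quotient.mk_surjective _ x
    obtain ⟨y, rfl⟩ := Submodule.Quotient.mk_surjective _ y
    rw [hzero x, hzero y]
  have h0 : Module.finrank (ZMod p) (ModN D p) = 0 := Module.finrank_zero_of_subsingleton
  rw [selmerCorank_eq_zpCorank_selmerDivisiblePart W p, ← pow_finrank_eq_natCard (p := p)]
  unfold zpCorank
  rw [h0, Nat.sub_zero]

end DivisiblePart

/-! ## §2 Exactness of `H¹(K, E[φ] ∩ E[p^∞]) → H¹(K, E[p^∞]) →(φ_*) H¹(K, E'[p^∞])` -/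

section Exactness

variable {K : Type u} [Field K] {W W' : WeierstrassCurve K} (p : ℕ)

/-- **An isogeny of elliptic curves is onto on `p^∞`-torsion** (characteristic `0`): given
`Q ∈ E'[p^∞]`, `p^k Q = 0`, write `deg φ = n = p^a m` with `p ∤ m` and `m u ≡ 1 (mod p^k)`; then
`Q = m • (u • Q)`, `u • Q = φ P'` (`φ` is onto `K̄`-points, `Isogeny.surjective`), and
`P = m • P'` has `φ P = Q` and `p^{a+k} P = p^k • [n] P' = ψ (φ (p^k • u • Q)) = 0` for the dual
isogeny `ψ` (`Isogeny.exists_dual_of_isElliptic`). Silverman, *AEC*, III.4.10, III.6.1. [folklore] -/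
theorem _root_.WeierstrassCurve.Isogeny.primaryTorsionMap_surjective [CharZero K] [W.IsElliptic]
    [W'.IsElliptic] [hp : Fact p.Prime] (φ : Isogeny W W') :
    Function.Surjective (primaryTorsionMap p φ.toAddMonoidHom) := by
  intro Q
  obtain ⟨k, hk⟩ := (AddCommGroup.mem_primaryComponent).mp Q.2
  obtain ⟨ψ, hψ⟩ := φ.exists_dual_of_isElliptic
  obtain ⟨a, m, hm, hn⟩ := Nat.exists_eq_pow_mul_and_not_dvd φ.degree_pos.ne' p hp.out.ne_one
  -- `m` is invertible modulo `p ^ k`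
  obtain ⟨u, hu⟩ : ∃ u : ℕ, (m * u) • (Q : W'.geomPoints) = Q := by
    rcases Nat.eq_zero_or_pos k with rfl | hkpos
    · rw [pow_zero, one_smul] at hk
      exact ⟨0, by rw [hk, smul_zero]⟩
    have hcop : Nat.Coprime m (p ^ k) :=
      (((Nat.Prime.coprime_iff_not_dvd hp.out).mpr hm).symm).pow_right k
    obtain ⟨u, -, hu⟩ := Nat.exists_mul_mod_eq_one_of_coprime hcop
      (Nat.one_lt_pow hkpos.ne' hp.out.one_lt)
    exact ⟨u, by rw [nsmul_eq_mod_nsmul (m * u) hk, hu, one_smul]⟩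
  obtain ⟨P', hP'⟩ := φ.surjective (u • (Q : W'.geomPoints))
  refine ⟨⟨m • P', (AddCommGroup.mem_primaryComponent).mpr ⟨a + k, ?_⟩⟩, Subtype.ext ?_⟩
  · have h1 : p ^ (a + k) • m • P' = p ^ k • ((φ.degree : ℤ) • P') := by
      rw [hn, natCast_zsmul, smul_smul, smul_smul]
      congr 1
      ring
    have h2 : p ^ k • φ P' = 0 := by rw [hP', smul_comm, hk, smul_zero]
    rw [h1, ← hψ, ← map_nsmul, h2, map_zero]
  · rw [coe_primaryTorsionMap_apply, map_nsmul, Isogeny.coe_toAddMonoidHom, hP', smul_smul, hu]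

/-- **Exactness at `H¹(K, E[p^∞])`.** For a `Γ_K`-equivariant `f : E(K̄) → E'(K̄)` which is
onto on `p^∞`-torsion, a class `c ∈ H¹(K, E[p^∞])` dies under `φ_*` iff it is represented by
a continuous cocycle `a` with `f ∘ a = 0`, i.e. with values in `E[φ] ∩ E[p^∞]` (`= E[φ]` when
`deg φ` is a power of `p`): the piece `H¹(K, E[φ]) → H¹(K, E[p^∞]) → H¹(K, E'[p^∞])` of the
cohomology sequence of `0 → E[φ] → E[p^∞] →(φ) E'[p^∞] → 0`, on continuous cocycles
(if `f ∘ a₀ = ∂v`, lift `v = f(P)` and replace `a₀` by `a₀ - ∂P`). This is the sentence "From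
the exact sequence `H¹(G_ℚ, E^d[φ]) → H¹(G_ℚ, E^d[2^∞]) → H¹(G_ℚ, E^d_0[2^∞])`, we find that the
first map has kernel of dimension `r_{φ,div}`" of Smith, arXiv:2503.17619, proof of Prop. 1.18.
Serre, *Galois Cohomology*, I.§2.2 (long exact sequence). [folklore] -/
theorem mem_ker_galH1PrimaryMap_iff (f : W.geomPoints →+ W'.geomPoints)
    (hf : ∀ (σ : Field.absoluteGaloisGroup K) (P : W.geomPoints), f (σ • P) = σ • f P)
    (hsurj : Function.Surjective (primaryTorsionMap p f)) (c : galH1Primary W p) :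
    galH1PrimaryMap p f hf c = 0 ↔
      ∃ a : contOneCocycles (discreteTopRep (Field.absoluteGaloisGroup K) (geomPrimaryTorsion W p)),
        oneCocycleClass _ a = c ∧ ∀ σ, primaryTorsionMap p f (a.1 σ) = 0 := by
  constructor
  · intro hc
    obtain ⟨a₀, rfl⟩ := oneCocycleClass_surjective _ c
    rw [galH1PrimaryMap_oneCocycleClass, oneCocycleClass_eq_zero_iff] at hc
    obtain ⟨v, hv⟩ := hc
    obtain ⟨P, rfl⟩ := hsurj v
    refine ⟨a₀ - cobCocycle P (continuous_smul_geomPrimaryTorsion W p P), ?_, fun σ ↦ ?_⟩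
    · rw [oneCocycleClass_sub, oneCocycleClass_cobCocycle, sub_zero]
    · have h := hv σ
      change primaryTorsionMap p f (a₀.1 σ) = σ • primaryTorsionMap p f P - primaryTorsionMap p f P
        at h
      change primaryTorsionMap p f (a₀.1 σ - (σ • P - P)) = 0
      rw [map_sub, map_sub, h, primaryTorsionMap_smul p f hf, sub_self]
  · rintro ⟨a, rfl, ha⟩
    rw [galH1PrimaryMap_oneCocycleClass]
    have h0 : contOneCocycles.push (primaryTorsionMap p f) (primaryTorsionMap_smul p f hf) a = 0 :=
      Subtype.ext (ContinuousMap.ext fun σ ↦ ha σ)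
    rw [h0, oneCocycleClass_zero]

/-- The same for an isogeny of elliptic curves in characteristic `0` (onto on `p^∞`-torsion by
`Isogeny.primaryTorsionMap_surjective`): **`ker φ_* = im (H¹(K, E[φ] ∩ E[p^∞]) → H¹(K, E[p^∞]))`**
on continuous cocycles. Smith, arXiv:2503.17619, proof of Prop. 1.18. [folklore] -/
theorem _root_.WeierstrassCurve.Isogeny.galH1PrimaryMap_eq_zero_iff [CharZero K] [W.IsElliptic]
    [W'.IsElliptic] [Fact p.Prime] (φ : Isogeny W W') (c : galH1Primary W p) :
    φ.galH1PrimaryMap p c = 0 ↔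
      ∃ a : contOneCocycles (discreteTopRep (Field.absoluteGaloisGroup K) (geomPrimaryTorsion W p)),
        oneCocycleClass _ a = c ∧ ∀ σ, φ (a.1 σ) = 0 := by
  rw [Isogeny.galH1PrimaryMap, mem_ker_galH1PrimaryMap_iff p φ.toAddMonoidHom φ.equivariant
    (φ.primaryTorsionMap_surjective p) c]
  refine exists_congr fun a ↦ and_congr Iff.rfl (forall_congr' fun σ ↦ ?_)
  rw [← Isogeny.coe_toAddMonoidHom, ← coe_primaryTorsionMap_apply p]
  exact ⟨fun h ↦ by rw [h]; rfl, fun h ↦ Subtype.ext h⟩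

end Exactness

/-! ## §3 `φ_*` on the divisible parts; the kernel count -/

section Functorial

variable {K : Type u} [Field K] [NumberField K] {W W' : WeierstrassCurve K} (p : ℕ)
  (f : W.geomPoints →+ W'.geomPoints)
  (hf : ∀ (σ : Field.absoluteGaloisGroup K) (P : W.geomPoints), f (σ • P) = σ • f P)
  (hloc : HasLocalPointsMaps W W' f)

include hloc in
/-- **`φ_* (Sel_div E) ⊆ Sel_div E'`**: the image of the divisible subgroup `Sel_div E` of
`Sel_{p^∞}(E)` is a `p`-divisible subgroup of `Sel_{p^∞}(E')`. Smith, arXiv:2503.17619, proof of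
Prop. 1.18 (the map `Sel^{2^∞}_{div} E^d →(φ) Sel^{2^∞}_{div} E^d_0`). [folklore] -/
theorem map_galH1PrimaryMap_selmerDivisiblePart_le [Finite (selmerGroupPInfty W p)[(p : ℤ)]] :
    (selmerDivisiblePart W p).map (galH1PrimaryMap p f hf) ≤ selmerDivisiblePart W' p := by
  refine le_selmerDivisiblePart_of_pDivisible W' p ?_ ?_
  · rintro _ ⟨d, hd, rfl⟩
    exact galH1PrimaryMap_mem_selmerGroupPInfty p f hf hloc (selmerDivisiblePart_le W p hd)
  · rintro _ ⟨d, hd, rfl⟩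
    obtain ⟨d', hd', rfl⟩ := selmerDivisiblePart_pDivisible W p hd
    exact ⟨galH1PrimaryMap p f hf d', ⟨d', hd', rfl⟩, (map_nsmul _ _ _).symm⟩

variable (g : W'.geomPoints →+ W.geomPoints)
  (hg : ∀ (σ : Field.absoluteGaloisGroup K) (Q : W'.geomPoints), g (σ • Q) = σ • g Q)
  (hloc' : HasLocalPointsMaps W' W g)

include hg hloc hloc' in
/-- **`φ_* (Sel_div E) = Sel_div E'`** when there is `g` (the dual isogeny) with `f ∘ g = [n]`,
`n ≥ 1`: `Sel_div E' = n · Sel_div E' = φ_* ψ_* (Sel_div E') ⊆ φ_* (Sel_div E)` by divisibility.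
This is the surjectivity of `Sel^{2^∞}_{div} E^d →(φ) Sel^{2^∞}_{div} E^d_0` implicit in Smith's
kernel count (proof of Prop. 1.18). [folklore] -/
theorem map_galH1PrimaryMap_selmerDivisiblePart_eq [Fact p.Prime]
    [Finite (selmerGroupPInfty W p)[(p : ℤ)]] [Finite (selmerGroupPInfty W' p)[(p : ℤ)]] {n : ℕ}
    (hn : 0 < n) (hfg : ∀ Q : W'.geomPoints, f (g Q) = (n : ℤ) • Q) :
    (selmerDivisiblePart W p).map (galH1PrimaryMap p f hf) = selmerDivisiblePart W' p := by
  refine le_antisymm (map_galH1PrimaryMap_selmerDivisiblePart_le p f hf hloc) fun d hd ↦ ?_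
  obtain ⟨d', hd', rfl⟩ := selmerDivisiblePart_divisible W' p hd hn
  refine ⟨galH1PrimaryMap p g hg d', map_galH1PrimaryMap_selmerDivisiblePart_le p g hg hloc'
    ⟨d', hd', rfl⟩, ?_⟩
  rw [galH1PrimaryMap_galH1PrimaryMap_of_comp_eq_nsmul p g hg f hf hfg]

include hloc hloc' in
/-- **The kernel count** along `Sel_div E →(φ_*) Sel_div E' →(ψ_*) Sel_div E` with
`ψ_* ∘ φ_* = n` (`g ∘ f = [n]`, `f ∘ g = [n]`, `n ≥ 1`): since `φ_*` is onto `Sel_div E'`,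
`#(Sel_div E)[n] = #ker(ψ_* φ_*) = #(Sel_div E ∩ ker φ_*) · #(Sel_div E' ∩ ker ψ_*)`. Smith,
arXiv:2503.17619, proof of Prop. 1.18 ("the first map … has kernel of dimension `r_{φ,div}(E^d)`;
similarly, the second map has kernel of dimension `r_{φ',div}(E_0^d)`. Meanwhile, their
composition has kernel of dimension `r_{2^∞}(E^d)`"). [cite: arXiv250317619, Prop. 1.18 (proof)] -/
theorem natCard_torsionBy_selmerDivisiblePart_eq_mul [Fact p.Prime]
    [Finite (selmerGroupPInfty W p)[(p : ℤ)]] [Finite (selmerGroupPInfty W' p)[(p : ℤ)]] {n : ℕ}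
    (hn : 0 < n) (hgf : ∀ P : W.geomPoints, g (f P) = (n : ℤ) • P)
    (hfg : ∀ Q : W'.geomPoints, f (g Q) = (n : ℤ) • Q) :
    Nat.card (selmerDivisiblePart W p)[(n : ℤ)] =
      Nat.card ↥(selmerDivisiblePart W p ⊓ (galH1PrimaryMap p f hf).ker) *
        Nat.card ↥(selmerDivisiblePart W' p ⊓ (galH1PrimaryMap p g hg).ker) := by
  set D := selmerDivisiblePart W p with hD_def
  set D' := selmerDivisiblePart W' p with hD'_def
  have hFmem : ∀ d : D, galH1PrimaryMap p f hf d ∈ D' := fun d ↦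
    map_galH1PrimaryMap_selmerDivisiblePart_le p f hf hloc ⟨d, d.2, rfl⟩
  have hGmem : ∀ d : D', galH1PrimaryMap p g hg d ∈ D := fun d ↦
    map_galH1PrimaryMap_selmerDivisiblePart_le p g hg hloc' ⟨d, d.2, rfl⟩
  let F : D →+ D' := ((galH1PrimaryMap p f hf).comp D.subtype).codRestrict D' hFmem
  let G : D' →+ D := ((galH1PrimaryMap p g hg).comp D'.subtype).codRestrict D hGmem
  have hF : ∀ d : D, ((F d : D') : galH1Primary W' p) = galH1PrimaryMap p f hf d := fun _ ↦ rfl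
  have hG : ∀ d : D', ((G d : D) : galH1Primary W p) = galH1PrimaryMap p g hg d := fun _ ↦ rfl
  -- `F` is onto
  have hFsurj : Function.Surjective F := fun d' ↦ by
    have h : (d' : galH1Primary W' p) ∈ D.map (galH1PrimaryMap p f hf) := by
      rw [map_galH1PrimaryMap_selmerDivisiblePart_eq p f hf hloc g hg hloc' hn hfg]; exact d'.2
    obtain ⟨d, hd, hdd'⟩ := h
    exact ⟨⟨d, hd⟩, Subtype.ext hdd'⟩
  -- `G ∘ F = n`
  have hGF : (G.comp F).ker = D[(n : ℤ)] := by
    ext d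
    rw [AddMonoidHom.mem_ker, AddMonoidHom.comp_apply]
    change G (F d) = 0 ↔ d ∈ AddSubgroup.torsionBy D (n : ℤ)
    rw [AddSubgroup.torsionBy.nsmul_iff]
    constructor <;> intro h
    · have h' := congrArg (fun z : D ↦ (z : galH1Primary W p)) h
      simp only [hG, hF, ZeroMemClass.coe_zero,
        galH1PrimaryMap_galH1PrimaryMap_of_comp_eq_nsmul p f hf g hg hgf] at h'
      exact Subtype.ext (by rw [AddSubgroupClass.coe_nsmul, h', ZeroMemClass.coe_zero])
    · apply Subtype.ext
      rw [hG, hF, galH1PrimaryMap_galH1PrimaryMap_of_comp_eq_nsmul p f hf g hg hgf,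
        ← AddSubgroupClass.coe_nsmul, h]
  -- kernels of `F`, `G`
  have hkerF : Nat.card F.ker = Nat.card ↥(D ⊓ (galH1PrimaryMap p f hf).ker) := by
    refine Nat.card_congr
      { toFun := fun x ↦ ⟨(x.1 : galH1Primary W p), AddSubgroup.mem_inf.mpr ⟨x.1.2, ?_⟩⟩
        invFun := fun y ↦ ⟨⟨y.1, (AddSubgroup.mem_inf.mp y.2).1⟩, ?_⟩
        left_inv := fun x ↦ Subtype.ext (Subtype.ext rfl)
        right_inv := fun y ↦ Subtype.ext rfl }
    · have hx := x.2
      rw [AddMonoidHom.mem_ker] at hx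
      exact congrArg (fun z : D' ↦ (z : galH1Primary W' p)) hx
    · rw [AddMonoidHom.mem_ker]
      exact Subtype.ext (AddSubgroup.mem_inf.mp y.2).2
  have hkerG : Nat.card G.ker = Nat.card ↥(D' ⊓ (galH1PrimaryMap p g hg).ker) := by
    refine Nat.card_congr
      { toFun := fun x ↦ ⟨(x.1 : galH1Primary W' p), AddSubgroup.mem_inf.mpr ⟨x.1.2, ?_⟩⟩
        invFun := fun y ↦ ⟨⟨y.1, (AddSubgroup.mem_inf.mp y.2).1⟩, ?_⟩
        left_inv := fun x ↦ Subtype.ext (Subtype.ext rfl)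
        right_inv := fun y ↦ Subtype.ext rfl }
    · have hx := x.2
      rw [AddMonoidHom.mem_ker] at hx
      exact congrArg (fun z : D ↦ (z : galH1Primary W p)) hx
    · rw [AddMonoidHom.mem_ker]
      exact Subtype.ext (AddSubgroup.mem_inf.mp y.2).2
  -- `#ker (G ∘ F) = #ker G · #ker F` for `F` onto
  have hcount : Nat.card (G.comp F).ker = Nat.card G.ker * Nat.card F.ker := by
    have hle : F.ker ≤ (G.comp F).ker := fun x hx ↦ by
      rw [AddMonoidHom.mem_ker] at hx
      rw [AddMonoidHom.mem_ker, AddMonoidHom.comp_apply, hx, map_zero]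
    have h1 : F.ker.relIndex (G.comp F).ker = Nat.card G.ker := by
      rw [← AddMonoidHom.comap_bot, show (G.comp F).ker = G.ker.comap F from
        (AddMonoidHom.comap_ker G F).symm, AddSubgroup.relIndex_comap,
        AddSubgroup.map_comap_eq_self_of_surjective hFsurj, AddSubgroup.relIndex_bot_left]
    have h2 := AddSubgroup.relIndex_mul_relIndex (H := ⊥) (K := F.ker) (L := (G.comp F).ker)
      bot_le hle
    rw [AddSubgroup.relIndex_bot_left, AddSubgroup.relIndex_bot_left, h1] at h2
    rw [← h2, mul_comm]
  rw [← hGF, hcount, hkerF, hkerG, mul_comm]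

end Functorial

/-! ## §4 Smith's Prop. 1.18: `r_{p^∞}(E) = r_{φ,div}(E) + r_{ψ,div}(E')` -/

section Prop118

variable {K : Type u} [Field K] [NumberField K] {W W' : WeierstrassCurve K} (p : ℕ)
  [hp : Fact p.Prime]

/-- **`Sel_div ∩ ker φ_*` is an `𝔽_p`-space of dimension `r_{φ,div}`**: if `g ∘ f = [p]` then
`ker φ_*` is killed by `p`, so `X = Sel_div E ∩ ker φ_*` equals its `p`-torsion and
`#X = p ^ r_{φ,div}` for `r_{φ,div} = dim_{𝔽_p} X[p]` (`selmerDivRank`). [folklore] -/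
theorem natCard_selmerDivisiblePart_inf_ker [Finite (selmerGroupPInfty W p)[(p : ℤ)]]
    (f : W.geomPoints →+ W'.geomPoints)
    (hf : ∀ (σ : Field.absoluteGaloisGroup K) (P : W.geomPoints), f (σ • P) = σ • f P)
    (g : W'.geomPoints →+ W.geomPoints)
    (hg : ∀ (σ : Field.absoluteGaloisGroup K) (Q : W'.geomPoints), g (σ • Q) = σ • g Q)
    (hgf : ∀ P : W.geomPoints, g (f P) = (p : ℤ) • P) :
    Nat.card ↥(selmerDivisiblePart W p ⊓ (galH1PrimaryMap p f hf).ker) =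
      p ^ selmerDivRank p f hf := by
  set X := selmerDivisiblePart W p ⊓ (galH1PrimaryMap p f hf).ker with hX_def
  letI : Module (ZMod p) X[(p : ℤ)] := AddSubgroup.torsionBy.zmodModule
  -- `X` is killed by `p`, so `X[p] ≃ X`
  have hkill : ∀ x : X, p • x = 0 := fun x ↦ Subtype.ext (by
    rw [AddSubgroupClass.coe_nsmul, ZeroMemClass.coe_zero]
    exact nsmul_eq_zero_of_galH1PrimaryMap_eq_zero p f hf g hg hgf (AddSubgroup.mem_inf.mp x.2).2)
  have e : X[(p : ℤ)] ≃ X :=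
    { toFun := fun x ↦ x.1
      invFun := fun x ↦ ⟨x, AddSubgroup.torsionBy.nsmul_iff.mpr (hkill x)⟩
      left_inv := fun x ↦ Subtype.ext rfl
      right_inv := fun x ↦ rfl }
  -- `X[p]` is finite (inside `Sel_div[p]`)
  haveI : Finite X[(p : ℤ)] := by
    haveI := finite_torsionBy_selmerDivisiblePart W p
    refine Finite.of_injective (fun x : X[(p : ℤ)] ↦
      (⟨⟨(x.1 : galH1Primary W p), (AddSubgroup.mem_inf.mp x.1.2).1⟩,
        AddSubgroup.torsionBy.nsmul_iff.mpr (Subtype.ext ?_)⟩ :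
          (selmerDivisiblePart W p)[(p : ℤ)])) ?_
    · have h := congrArg (fun z : X ↦ (z : galH1Primary W p)) (hkill x.1)
      simpa only [AddSubgroupClass.coe_nsmul, ZeroMemClass.coe_zero] using h
    · intro x y hxy
      exact Subtype.ext (Subtype.ext (congrArg
        (fun z : (selmerDivisiblePart W p)[(p : ℤ)] ↦ ((z : selmerDivisiblePart W p) :
          galH1Primary W p)) hxy))
  rw [← Nat.card_congr e, ← pow_finrank_eq_natCard (p := p)]
  rfl

/-- **Smith's Prop. 1.18, second equality** (arXiv:2503.17619, §1.2), for homomorphisms: let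
`f : E(K̄) → E'(K̄)`, `g : E'(K̄) → E(K̄)` be `Γ_K`-equivariant with local points maps and
`g ∘ f = [p]`, `f ∘ g = [p]` (a degree-`p` isogeny and its dual; Smith: `p = 2`). Then
`corank_{ℤ_p} Sel_{p^∞}(E/K) = r_{φ,div}(E) + r_{ψ,div}(E')`. Proof as printed: multiplication by
`p` on `Sel_div E ≅ (ℚ_p/ℤ_p)^r` (kernel of order `p^r`, `natCard_torsionBy_selmerDivisiblePart`)
factors as `Sel_div E →(φ_*) Sel_div E' →(ψ_*) Sel_div E` with the first map onto, so
`p^r = #(Sel_div E ∩ ker φ_*) · #(Sel_div E' ∩ ker ψ_*) = p^{r_{φ,div}} · p^{r_{ψ,div}}`.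
[cite: arXiv250317619, Prop. 1.18] -/
theorem selmerCorank_eq_selmerDivRank_add [Finite (selmerGroupPInfty W p)[(p : ℤ)]]
    [Finite (selmerGroupPInfty W' p)[(p : ℤ)]] (f : W.geomPoints →+ W'.geomPoints)
    (hf : ∀ (σ : Field.absoluteGaloisGroup K) (P : W.geomPoints), f (σ • P) = σ • f P)
    (hloc : HasLocalPointsMaps W W' f) (g : W'.geomPoints →+ W.geomPoints)
    (hg : ∀ (σ : Field.absoluteGaloisGroup K) (Q : W'.geomPoints), g (σ • Q) = σ • g Q)
    (hloc' : HasLocalPointsMaps W' W g) (hgf : ∀ P : W.geomPoints, g (f P) = (p : ℤ) • P)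
    (hfg : ∀ Q : W'.geomPoints, f (g Q) = (p : ℤ) • Q) :
    W.selmerCorank p = selmerDivRank p f hf + selmerDivRank p g hg := by
  have h := natCard_torsionBy_selmerDivisiblePart_eq_mul p f hf hloc g hg hloc' hp.out.pos hgf hfg
  rw [natCard_torsionBy_selmerDivisiblePart W p, natCard_selmerDivisiblePart_inf_ker p f hf g hg hgf,
    natCard_selmerDivisiblePart_inf_ker p g hg f hf hfg, ← pow_add] at h
  exact Nat.pow_right_injective hp.out.two_le h

/-- **Smith's Prop. 1.18** (arXiv:2503.17619, §1.2: "Choose a `ℚ`-isogeny `φ : E → E_0` of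
degree `2` … and take `φ' : E_0 → E` to be the dual isogeny to `φ`. Then
`r_{2^∞}(E^d) = r_{2^∞}(E_0^d) = r_{φ,div}(E^d) + r_{φ',div}(E_0^d)`"), for elliptic curves over a
number field `K` (with `Sel_{p^∞}[p]` finite — always: `finite_torsionBy_selmerGroupPInfty`), a
prime `p` and isogenies `φ : E → E'`, `ψ : E' → E` over `K` with `ψ ∘ φ = [p]` (so `φ ∘ ψ = [p]`,
from the surjectivity of `φ`): **`corank_{ℤ_p} Sel_{p^∞}(E/K) = r_{φ,div}(E) + r_{ψ,div}(E')`** and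
**`corank_{ℤ_p} Sel_{p^∞}(E/K) = corank_{ℤ_p} Sel_{p^∞}(E'/K)`**. Applied to the twists `E^d`,
`E_0^d` and the twisted isogenies at `p = 2` this is the printed statement (companion file
`BSDSelmerSmithIsogenyTrickProofs`). [cite: arXiv250317619, Prop. 1.18] -/
theorem _root_.WeierstrassCurve.Isogeny.selmerCorank_eq_divRank_add_divRank [W.IsElliptic]
    [W'.IsElliptic] [Finite (selmerGroupPInfty W p)[(p : ℤ)]]
    [Finite (selmerGroupPInfty W' p)[(p : ℤ)]] (φ : Isogeny W W') (ψ : Isogeny W' W)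
    (hψφ : ∀ P : W.geomPoints, ψ (φ P) = (p : ℤ) • P) :
    W.selmerCorank p = φ.divRank p + ψ.divRank p ∧ W'.selmerCorank p = φ.divRank p + ψ.divRank p := by
  have hφψ : ∀ Q : W'.geomPoints, φ (ψ Q) = (p : ℤ) • Q := fun Q ↦ by
    obtain ⟨P, rfl⟩ := φ.surjective Q
    rw [hψφ P, map_zsmul]
  refine ⟨selmerCorank_eq_selmerDivRank_add p φ.toAddMonoidHom φ.equivariant
      φ.hasLocalPointsMaps_toAddMonoidHom ψ.toAddMonoidHom ψ.equivariant
      ψ.hasLocalPointsMaps_toAddMonoidHom hψφ hφψ, ?_⟩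
  rw [add_comm]
  exact selmerCorank_eq_selmerDivRank_add p ψ.toAddMonoidHom ψ.equivariant
    ψ.hasLocalPointsMaps_toAddMonoidHom φ.toAddMonoidHom φ.equivariant
    φ.hasLocalPointsMaps_toAddMonoidHom hφψ hψφ

end Prop118

end Literature.NumberTheory.EllipticCurves

end
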